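import Mathlib
import HarnessLib
import Literature.MathematicalPhysics.QuantumFieldTheory.OSReconstructionNoE1
import Literature.MathematicalPhysics.QuantumLattice.SchwartzNuclearExpansionBounds
import Summits.QuantumFields.YangMills.Theorems.PencilRigidityCurvatureKernelBoundChartDerivativeBoundsFrame
import Summits.QuantumFields.YangMills.Theorems.PencilRigidityCurvatureKernelBoundChartDerivativeBoundsTensor
import Summits.QuantumFields.YangMills.Theorems.PencilRigidityCurvatureKernelBoundChartDerivativeBoundsTranslation

/-!
# `CurvatureKernelBound` — stub A3 support: dilations and the scaled chart bounds

Support file for crux `stmt-QuantumFields-11687` (`PencilRigidity.CurvatureKernelBound`), line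
`sixteen-charts-analytic-kernel`, stub `KernelOffDiagonal` (A3).

* dilations `dilateTest s` (`f ↦ f(s⁻¹ ·)`, `s > 0`) of one- and two-point test functions: tensors,
  iterated line derivatives (`D_s ∂ᴺ = sᴺ ∂ᴺ D_s`), supports, Schwartz norms
  (`|D_s f|_M ≤ (s + s⁻¹)^{2M} |f|_M`);
* the chart bound of stub A1 (pure `n`-derivatives of `f ⊗ g` for `supp f ⊆ {⟪x,n⟫ < 0}`,
  `supp g ⊆ {⟪x,n⟫ > δ}`) transported by a translation along `n` to supports separated by a slab
  `{⟪x,n⟫ < α}`, `{⟪x,n⟫ > α + δ}`;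
* the **scaled chart bound** (registered sub-goal `ScaledChartBound`): at a configuration `(ξ, 0)`
  with four unit normals `n_j`, `⟪ξ, n_j⟫ ≤ -3d < 0`, the dilated two-point functional
  `F ↦ 𝔖₂(D_s F)` obeys the hypothesis of stub A2 on `U = {⟪x - ξ, n_i⟫ < d}`, `V = {⟪y, n_i⟫ > -d}` with
  a constant `C₀ (s + s⁻¹)^q`, polynomial in `s, s⁻¹`.
[folklore]
-/

noncomputable section

open scoped SchwartzMap LineDeriv InnerProductSpace
open Set MeasureTheory
open Literature.MathematicalPhysics.AQFT Literature.MathematicalPhysics.QuantumLattice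
open Literature.MathematicalPhysics.QuantumFieldTheory

namespace Summit.QuantumFields.YangMills.Theorems.CurvatureKernel

/-! ## Dilations of test functions -/

section Dilation

variable {V : Type*} [NormedAddCommGroup V] [NormedSpace ℝ V]

/-- Supports of dilates: `x ∈ supp f(s⁻¹ ·) → s⁻¹ x ∈ supp f`. [folklore] -/
theorem inv_smul_mem_tsupport_of_mem_tsupport_dilateTest {s : ℝ} (hs : s ≠ 0) (f : 𝓢(V, ℂ)) {x : V}
    (hx : x ∈ tsupport ((dilateTest s hs f : 𝓢(V, ℂ)) : V → ℂ)) : s⁻¹ • x ∈ tsupport (f : V → ℂ) := by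
  have h : ((dilateTest s hs f : 𝓢(V, ℂ)) : V → ℂ) = (f : V → ℂ) ∘ fun x => s⁻¹ • x :=
    funext fun y => dilateTest_apply s hs f y
  rw [h] at hx
  exact tsupport_comp_subset_preimage (f : V → ℂ) (continuous_const_smul s⁻¹) hx

/-- Iterated line derivatives along a scaled direction, pointwise: `((∂_{c v})^[N] f)(x) = cᴺ ((∂_v)^[N] f)(x)`.
[folklore] -/
theorem iterate_lineDerivOp_left_smul_apply (c : ℝ) (v : V) (N : ℕ) (f : 𝓢(V, ℂ)) (x : V) :
    ((∂_{c • v} : 𝓢(V, ℂ) → 𝓢(V, ℂ))^[N] f) x = (c : ℂ) ^ N * ((∂_{v} : 𝓢(V, ℂ) → 𝓢(V, ℂ))^[N] f) x := by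
  induction N generalizing x with
  | zero => simp
  | succ N ih =>
    have hfun : ((∂_{c • v} : 𝓢(V, ℂ) → 𝓢(V, ℂ))^[N] f) = ((c : ℂ) ^ N) • ((∂_{v} : 𝓢(V, ℂ) → 𝓢(V, ℂ))^[N] f) := by
      ext y
      rw [ih y, smul_apply, smul_eq_mul]
    rw [Function.iterate_succ_apply', Function.iterate_succ_apply', hfun, LineDeriv.lineDerivOp_smul,
      LineDerivLeftSMul.lineDerivOp_left_smul, smul_apply, smul_apply, smul_eq_mul,
      Complex.real_smul, pow_succ]
    ring

/-- **Chain rule for dilations**: `D_s ((∂_v)^[N] f) = sᴺ (∂_v)^[N] (D_s f)`. [folklore] -/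
theorem dilateTest_iterate_lineDerivOp {s : ℝ} (hs : s ≠ 0) (v : V) (N : ℕ) (f : 𝓢(V, ℂ)) :
    dilateTest s hs (((∂_{v} : 𝓢(V, ℂ) → 𝓢(V, ℂ))^[N] f)) =
      ((s : ℂ) ^ N) • ((∂_{v} : 𝓢(V, ℂ) → 𝓢(V, ℂ))^[N] (dilateTest s hs f)) := by
  have hL : ∀ w : V, (ContinuousLinearEquiv.smulLeft (Units.mk0 s hs)⁻¹ : V ≃L[ℝ] V) w = s⁻¹ • w := by
    intro w
    show ((Units.mk0 s hs)⁻¹ : ℝˣ) • w = s⁻¹ • w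
    rw [Units.smul_def, Units.val_inv_eq_inv_val, Units.val_mk0]
  have h1 : ((∂_{v} : 𝓢(V, ℂ) → 𝓢(V, ℂ))^[N] (dilateTest s hs f)) =
      dilateTest s hs (((∂_{s⁻¹ • v} : 𝓢(V, ℂ) → 𝓢(V, ℂ))^[N] f)) := by
    change ((∂_{v} : 𝓢(V, ℂ) → 𝓢(V, ℂ))^[N] (SchwartzMap.compCLMOfContinuousLinearEquiv ℂ
      (ContinuousLinearEquiv.smulLeft (Units.mk0 s hs)⁻¹ : V ≃L[ℝ] V) f)) = _
    rw [iterate_lineDerivOp_compCLMOfContinuousLinearEquiv, hL]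
    rfl
  ext x
  rw [h1, smul_apply, dilateTest_apply, dilateTest_apply, iterate_lineDerivOp_left_smul_apply,
    smul_eq_mul, ← mul_assoc, ← mul_pow, Complex.ofReal_inv, mul_inv_cancel₀ (Complex.ofReal_ne_zero.2 hs),
    one_pow, one_mul]

/-- **Schwartz norms of dilates**: `|f(s⁻¹ ·)|_M ≤ (s + s⁻¹)^{2M} |f|_M` for `s > 0`. [folklore] -/
theorem schwartzNorm_dilateTest_le {s : ℝ} (hs : 0 < s) (M : ℕ) (f : 𝓢(V, ℂ)) :
    schwartzNorm M (dilateTest s hs.ne' f) ≤ (s + s⁻¹) ^ (2 * M) * schwartzNorm M f := by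
  set L : V ≃L[ℝ] V := ContinuousLinearEquiv.smulLeft (Units.mk0 s hs.ne')⁻¹ with hLdef
  have hL : ∀ w : V, L w = s⁻¹ • w := by
    intro w
    show ((Units.mk0 s hs.ne')⁻¹ : ℝˣ) • w = s⁻¹ • w
    rw [Units.smul_def, Units.val_inv_eq_inv_val, Units.val_mk0]
  have hLs : ∀ w : V, L.symm w = s • w := by
    intro w
    apply L.injective
    rw [L.apply_symm_apply, hL, smul_smul, inv_mul_cancel₀ hs.ne', one_smul]
  have h := NuclearExpansion.schwartzNorm_compCLMOfContinuousLinearEquiv_le M L f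
  have hs1 : (1 : ℝ) ≤ s + s⁻¹ := by
    rcases le_or_gt 1 s with h1 | h1
    · linarith [inv_pos.2 hs]
    · have : 1 ≤ s⁻¹ := (one_le_inv₀ hs).2 h1.le
      linarith
  have hn1 : ‖(L : V →L[ℝ] V)‖ ≤ s + s⁻¹ := by
    refine ContinuousLinearMap.opNorm_le_bound _ (by positivity) fun x => ?_
    rw [ContinuousLinearEquiv.coe_coe, hL, norm_smul, Real.norm_of_nonneg (inv_pos.2 hs).le]
    exact mul_le_mul_of_nonneg_right (by linarith) (norm_nonneg _)
  have hn2 : ‖(L.symm : V →L[ℝ] V)‖ ≤ s + s⁻¹ := by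
    refine ContinuousLinearMap.opNorm_le_bound _ (by positivity) fun x => ?_
    rw [ContinuousLinearEquiv.coe_coe, hLs, norm_smul, Real.norm_of_nonneg hs.le]
    exact mul_le_mul_of_nonneg_right (by linarith [inv_pos.2 hs]) (norm_nonneg _)
  have hmax : max 1 (max ‖(L.symm : V →L[ℝ] V)‖ ‖(L : V →L[ℝ] V)‖) ≤ s + s⁻¹ := max_le hs1 (max_le hn2 hn1)
  refine h.trans (mul_le_mul_of_nonneg_right ?_ (schwartzNorm_nonneg M f))
  exact pow_le_pow_left₀ (by positivity) hmax _

/-- Dilating a two-point tensor dilates the factors. [folklore] -/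
theorem dilateTest_tensorFin_two {s : ℝ} (hs : s ≠ 0) (f g : 𝓢(V, ℂ)) :
    dilateTest s hs (SchwartzMap.tensorFin 2 ![f, g]) =
      SchwartzMap.tensorFin 2 ![dilateTest s hs f, dilateTest s hs g] := by
  ext x
  simp

/-- Dilation preserves supports off the diagonal. [folklore] -/
theorem tsupport_dilateTest_subset_offDiagonal {s : ℝ} (hs : s ≠ 0) {F : 𝓢((Fin 2 → V), ℂ)}
    (hF : tsupport (F : (Fin 2 → V) → ℂ) ⊆ {x | x 0 ≠ x 1}) :
    tsupport ((dilateTest s hs F : 𝓢((Fin 2 → V), ℂ)) : (Fin 2 → V) → ℂ) ⊆ {x | x 0 ≠ x 1} := by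
  intro x hx h01
  have h := hF (inv_smul_mem_tsupport_of_mem_tsupport_dilateTest hs F hx)
  simp only [mem_setOf_eq, Pi.smul_apply, ne_eq] at h
  exact h (by rw [h01])

/-- Dilation preserves compact support. [folklore] -/
theorem hasCompactSupport_dilateTest {s : ℝ} (hs : s ≠ 0) {F : 𝓢(V, ℂ)}
    (hF : HasCompactSupport (F : V → ℂ)) : HasCompactSupport ((dilateTest s hs F : 𝓢(V, ℂ)) : V → ℂ) := by
  have h : ((dilateTest s hs F : 𝓢(V, ℂ)) : V → ℂ) =
      (F : V → ℂ) ∘ (ContinuousLinearEquiv.smulLeft (Units.mk0 s hs)⁻¹ : V ≃L[ℝ] V).toHomeomorph := rfl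
  rw [h]
  exact hF.comp_homeomorph _

end Dilation

/-! ## The chart bound on slab-separated supports -/

section Slab

variable (S₁ : SchwingerFamily (EuclideanSpace ℝ (Fin 4)))

/-- **The chart bound of stub A1 on slab-separated supports.** If pure `n`-derivatives of
`f ⊗ g` are controlled by `C δ⁻ᵖ |f|_{M₀} |g|_{M₀}` for `supp f ⊆ {⟪x,n⟫ < 0}`, `supp g ⊆ {⟪x,n⟫ > δ}`
and `𝔖` is translation invariant on `⁰𝒮`, then for `supp f ⊆ {⟪x,n⟫ < α}`, `supp g ⊆ {⟪x,n⟫ > α + δ}`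
the same bound holds with an extra factor `(2(1 + |α|))^{2M₀}` (translate by `-α n`; the tensor is
off-diagonal because the supports are separated by the slab). [folklore] -/
theorem norm_two_point_le_of_slab
    (hT : ∀ (n : ℕ) (a : EuclideanSpace ℝ (Fin 4)) (F : 𝓢((Fin n → EuclideanSpace ℝ (Fin 4)), ℂ)),
      IsOffDiagonal F → S₁ n (translateMulti a F) = S₁ n F)
    {nv : EuclideanSpace ℝ (Fin 4)} (hn : ‖nv‖ = 1) {M₀ N : ℕ} {C : ℝ} {p : ℕ}
    (hA : ∀ δ : ℝ, 0 < δ → δ ≤ 1 → ∀ f g : 𝓢(EuclideanSpace ℝ (Fin 4), ℂ),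
      tsupport (f : EuclideanSpace ℝ (Fin 4) → ℂ) ⊆ {x | ⟪x, nv⟫_ℝ < 0} →
      tsupport (g : EuclideanSpace ℝ (Fin 4) → ℂ) ⊆ {x | δ < ⟪x, nv⟫_ℝ} →
      ∀ F : 𝓢((Fin 2 → EuclideanSpace ℝ (Fin 4)), ℂ),
        (IsTensorOf F ![((∂_{nv} : 𝓢(EuclideanSpace ℝ (Fin 4), ℂ) → 𝓢(EuclideanSpace ℝ (Fin 4), ℂ))^[N] f), g] ∨
          IsTensorOf F ![f, ((∂_{nv} : 𝓢(EuclideanSpace ℝ (Fin 4), ℂ) → 𝓢(EuclideanSpace ℝ (Fin 4), ℂ))^[N] g)]) →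
        ‖S₁ 2 F‖ ≤ C * (1 / δ) ^ p * schwartzNorm M₀ f * schwartzNorm M₀ g)
    {α δ : ℝ} (hδ : 0 < δ) (hδ1 : δ ≤ 1) (f g : 𝓢(EuclideanSpace ℝ (Fin 4), ℂ))
    (hf : tsupport (f : EuclideanSpace ℝ (Fin 4) → ℂ) ⊆ {x | ⟪x, nv⟫_ℝ < α})
    (hg : tsupport (g : EuclideanSpace ℝ (Fin 4) → ℂ) ⊆ {x | α + δ < ⟪x, nv⟫_ℝ})
    (F : 𝓢((Fin 2 → EuclideanSpace ℝ (Fin 4)), ℂ))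
    (hF : IsTensorOf F ![((∂_{nv} : 𝓢(EuclideanSpace ℝ (Fin 4), ℂ) → 𝓢(EuclideanSpace ℝ (Fin 4), ℂ))^[N] f), g] ∨
      IsTensorOf F ![f, ((∂_{nv} : 𝓢(EuclideanSpace ℝ (Fin 4), ℂ) → 𝓢(EuclideanSpace ℝ (Fin 4), ℂ))^[N] g)]) :
    ‖S₁ 2 F‖ ≤ |C| * (1 / δ) ^ p * (2 * (1 + |α|)) ^ (2 * M₀) * schwartzNorm M₀ f * schwartzNorm M₀ g := by
  set b : EuclideanSpace ℝ (Fin 4) := (-α) • nv with hb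
  have hbn : ⟪b, nv⟫_ℝ = -α := by
    rw [hb, real_inner_smul_left, real_inner_self_eq_norm_sq, hn, one_pow, mul_one]
  have hnb : ‖b‖ = |α| := by rw [hb, norm_smul, hn, mul_one, Real.norm_eq_abs, abs_neg]
  set f' : 𝓢(EuclideanSpace ℝ (Fin 4), ℂ) := SchwartzMap.compSubConstCLM ℂ b f with hf'def
  set g' : 𝓢(EuclideanSpace ℝ (Fin 4), ℂ) := SchwartzMap.compSubConstCLM ℂ b g with hg'def
  have hf' : tsupport (f' : EuclideanSpace ℝ (Fin 4) → ℂ) ⊆ {x | ⟪x, nv⟫_ℝ < 0} := by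
    intro x hx
    have h := hf (sub_mem_tsupport_of_mem_tsupport_compSubConstCLM b f hx)
    simp only [mem_setOf_eq, inner_sub_left, hbn] at h ⊢
    linarith
  have hg' : tsupport (g' : EuclideanSpace ℝ (Fin 4) → ℂ) ⊆ {x | δ < ⟪x, nv⟫_ℝ} := by
    intro x hx
    have h := hg (sub_mem_tsupport_of_mem_tsupport_compSubConstCLM b g hx)
    simp only [mem_setOf_eq, inner_sub_left, hbn] at h ⊢
    linarith
  have hdisj : ∀ {φ ψ : 𝓢(EuclideanSpace ℝ (Fin 4), ℂ)},
      tsupport (φ : EuclideanSpace ℝ (Fin 4) → ℂ) ⊆ tsupport (f : EuclideanSpace ℝ (Fin 4) → ℂ) →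
      tsupport (ψ : EuclideanSpace ℝ (Fin 4) → ℂ) ⊆ tsupport (g : EuclideanSpace ℝ (Fin 4) → ℂ) →
      Disjoint (tsupport (φ : EuclideanSpace ℝ (Fin 4) → ℂ)) (tsupport (ψ : EuclideanSpace ℝ (Fin 4) → ℂ)) := by
    intro φ ψ hφ hψ
    refine Set.disjoint_left.2 fun x hx hx' => ?_
    have h1 := hf (hφ hx)
    have h2 := hg (hψ hx')
    simp only [mem_setOf_eq] at h1 h2
    linarith
  have hnf : schwartzNorm M₀ f' ≤ (2 * (1 + |α|)) ^ M₀ * schwartzNorm M₀ f := by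
    have := NuclearExpansion.schwartzNorm_compSubConstCLM_le M₀ b f
    rwa [hnb] at this
  have hng : schwartzNorm M₀ g' ≤ (2 * (1 + |α|)) ^ M₀ * schwartzNorm M₀ g := by
    have := NuclearExpansion.schwartzNorm_compSubConstCLM_le M₀ b g
    rwa [hnb] at this
  -- reduction to the translated tensor
  have key : ∀ (φ ψ : 𝓢(EuclideanSpace ℝ (Fin 4), ℂ)),
      tsupport (φ : EuclideanSpace ℝ (Fin 4) → ℂ) ⊆ tsupport (f : EuclideanSpace ℝ (Fin 4) → ℂ) →
      tsupport (ψ : EuclideanSpace ℝ (Fin 4) → ℂ) ⊆ tsupport (g : EuclideanSpace ℝ (Fin 4) → ℂ) →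
      IsTensorOf F ![φ, ψ] →
      S₁ 2 F = S₁ 2 (SchwartzMap.tensorFin 2
        ![SchwartzMap.compSubConstCLM ℂ b φ, SchwartzMap.compSubConstCLM ℂ b ψ]) := by
    intro φ ψ hφ hψ hFt
    rw [hFt.unique (isTensorOf_tensorFin _), ← translateMulti_tensorFin_two,
      hT 2 b _ (isOffDiagonal_tensorFin_two_of_disjoint (hdisj hφ hψ))]
  have h0 : 0 ≤ (1 / δ) ^ p * schwartzNorm M₀ f' * schwartzNorm M₀ g' :=
    mul_nonneg (mul_nonneg (by positivity) (schwartzNorm_nonneg _ _)) (schwartzNorm_nonneg _ _)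
  have hfin : C * (1 / δ) ^ p * schwartzNorm M₀ f' * schwartzNorm M₀ g' ≤
      |C| * (1 / δ) ^ p * (2 * (1 + |α|)) ^ (2 * M₀) * schwartzNorm M₀ f * schwartzNorm M₀ g := by
    have hsf := schwartzNorm_nonneg M₀ f
    have hsg := schwartzNorm_nonneg M₀ g
    have hsf' := schwartzNorm_nonneg M₀ f'
    have hsg' := schwartzNorm_nonneg M₀ g'
    calc C * (1 / δ) ^ p * schwartzNorm M₀ f' * schwartzNorm M₀ g'
        = C * ((1 / δ) ^ p * schwartzNorm M₀ f' * schwartzNorm M₀ g') := by ring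
      _ ≤ |C| * ((1 / δ) ^ p * schwartzNorm M₀ f' * schwartzNorm M₀ g') :=
          mul_le_mul_of_nonneg_right (le_abs_self C) h0
      _ ≤ |C| * ((1 / δ) ^ p * ((2 * (1 + |α|)) ^ M₀ * schwartzNorm M₀ f) *
            ((2 * (1 + |α|)) ^ M₀ * schwartzNorm M₀ g)) := by gcongr
      _ = _ := by ring
  rcases hF with hF | hF
  · rw [key _ _ (tsupport_iterate_lineDerivOp_subset nv N f) subset_rfl hF, ← iterate_lineDerivOp_compSubConstCLM]
    exact (hA δ hδ hδ1 f' g' hf' hg' _ (Or.inl (isTensorOf_tensorFin _))).trans hfin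
  · rw [key _ _ subset_rfl (tsupport_iterate_lineDerivOp_subset nv N g) hF, ← iterate_lineDerivOp_compSubConstCLM]
    exact (hA δ hδ hδ1 f' g' hf' hg' _ (Or.inr (isTensorOf_tensorFin _))).trans hfin

end Slab

/-! ## The scaled chart bound at a configuration `(ξ, 0)` -/

section Scaled

/-- Elementary bookkeeping: `1 / min (s d) 1 ≤ (s + s⁻¹)(1 + 1/d)`. [folklore] -/
theorem one_div_min_mul_le {s d : ℝ} (hs : 0 < s) (hd : 0 < d) :
    1 / min (s * d) 1 ≤ (s + s⁻¹) * (1 + 1 / d) := by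
  have hs' : 0 < s⁻¹ := inv_pos.2 hs
  have hd' : 0 < 1 / d := by positivity
  have h1 : (1 : ℝ) ≤ s + s⁻¹ := by
    rcases le_or_gt 1 s with h | h; · linarith
    linarith [(one_le_inv₀ hs).2 h.le]
  rcases min_cases (s * d) 1 with ⟨h, -⟩ | ⟨h, -⟩
  · rw [h]
    calc 1 / (s * d) = s⁻¹ * (1 / d) := by rw [one_div, mul_inv, one_div]
      _ ≤ (s + s⁻¹) * (1 / d) := mul_le_mul_of_nonneg_right (by linarith) hd'.le
      _ ≤ (s + s⁻¹) * (1 + 1 / d) := mul_le_mul_of_nonneg_left (by linarith) (by positivity)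
  · rw [h, div_one]
    nlinarith

variable (S₁ : SchwingerFamily (EuclideanSpace ℝ (Fin 4)))

/-- **The scaled chart bound.** Let `𝔖` be translation invariant on `⁰𝒮` and obey the chart bound of
stub A1 along four unit normals `n_j` with a common Schwartz order `M₀` and constants `C_{j,N}`,
`p_{j,N}`. At a configuration `(ξ, 0)` with `⟪ξ, n_j⟫ ≤ -3d < 0`, the dilated functional `F ↦ 𝔖₂(D_s F)`
(`s > 0`) satisfies, for `N ≤ N₁`, `supp f ⊆ U = {⟪x - ξ, n_i⟫ < d ∀ i}`, `supp g ⊆ V = {⟪y, n_i⟫ > -d ∀ i}`: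
`‖𝔖₂(D_s(∂_{n_j}ᴺ f ⊗ g))‖, ‖𝔖₂(D_s(f ⊗ ∂_{n_j}ᴺ g))‖ ≤ C₀ (s + s⁻¹)^q |f|_{M₀} |g|_{M₀}` with `q, C₀`
independent of `s` (chain rule `D_s ∂ᴺ = sᴺ ∂ᴺ D_s`, dilated supports are slab-separated with gap `s d`,
Schwartz norms of dilates and translates grow polynomially). [folklore] -/
theorem scaled_chart_bound
    (hT : ∀ (n : ℕ) (a : EuclideanSpace ℝ (Fin 4)) (F : 𝓢((Fin n → EuclideanSpace ℝ (Fin 4)), ℂ)),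
      IsOffDiagonal F → S₁ n (translateMulti a F) = S₁ n F)
    (nrm : Fin 4 → EuclideanSpace ℝ (Fin 4)) (hn1 : ∀ j, ‖nrm j‖ = 1) (M₀ : ℕ) (C : Fin 4 → ℕ → ℝ)
    (p : Fin 4 → ℕ → ℕ)
    (hA : ∀ (j : Fin 4) (N : ℕ) (δ : ℝ), 0 < δ → δ ≤ 1 → ∀ f g : 𝓢(EuclideanSpace ℝ (Fin 4), ℂ),
      tsupport (f : EuclideanSpace ℝ (Fin 4) → ℂ) ⊆ {x | ⟪x, nrm j⟫_ℝ < 0} →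
      tsupport (g : EuclideanSpace ℝ (Fin 4) → ℂ) ⊆ {x | δ < ⟪x, nrm j⟫_ℝ} →
      ∀ F : 𝓢((Fin 2 → EuclideanSpace ℝ (Fin 4)), ℂ),
        (IsTensorOf F ![((∂_{nrm j} : 𝓢(EuclideanSpace ℝ (Fin 4), ℂ) → 𝓢(EuclideanSpace ℝ (Fin 4), ℂ))^[N] f), g] ∨
          IsTensorOf F ![f, ((∂_{nrm j} : 𝓢(EuclideanSpace ℝ (Fin 4), ℂ) → 𝓢(EuclideanSpace ℝ (Fin 4), ℂ))^[N] g)]) →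
        ‖S₁ 2 F‖ ≤ C j N * (1 / δ) ^ (p j N) * schwartzNorm M₀ f * schwartzNorm M₀ g)
    (ξ : EuclideanSpace ℝ (Fin 4)) {d : ℝ} (hd : 0 < d) (hdξ : ∀ j, ⟪ξ, nrm j⟫_ℝ ≤ -(3 * d)) (N₁ : ℕ) :
    ∃ (q : ℕ) (C₀ : ℝ), 0 ≤ C₀ ∧ ∀ (s : ℝ) (hs : 0 < s) (j : Fin 4) (N : ℕ), N ≤ N₁ →
      ∀ f g : 𝓢(EuclideanSpace ℝ (Fin 4), ℂ),
        tsupport (f : EuclideanSpace ℝ (Fin 4) → ℂ) ⊆ {x | ∀ i, ⟪x - ξ, nrm i⟫_ℝ < d} →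
        tsupport (g : EuclideanSpace ℝ (Fin 4) → ℂ) ⊆ {y | ∀ i, -d < ⟪y, nrm i⟫_ℝ} →
        ∀ F : 𝓢((Fin 2 → EuclideanSpace ℝ (Fin 4)), ℂ),
          (IsTensorOf F ![((∂_{nrm j} : 𝓢(EuclideanSpace ℝ (Fin 4), ℂ) → 𝓢(EuclideanSpace ℝ (Fin 4), ℂ))^[N] f), g] ∨
            IsTensorOf F ![f, ((∂_{nrm j} : 𝓢(EuclideanSpace ℝ (Fin 4), ℂ) → 𝓢(EuclideanSpace ℝ (Fin 4), ℂ))^[N] g)]) →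
          ‖S₁ 2 (dilateTest s hs.ne' F)‖ ≤ C₀ * (s + s⁻¹) ^ q * schwartzNorm M₀ f * schwartzNorm M₀ g := by
  set P : ℕ := ∑ j, ∑ N ∈ Finset.range (N₁ + 1), p j N with hPdef
  set Cmax : ℝ := ∑ j, ∑ N ∈ Finset.range (N₁ + 1), |C j N| with hCmaxdef
  have hpP : ∀ j N, N ≤ N₁ → p j N ≤ P := by
    intro j N hN
    calc p j N ≤ ∑ N' ∈ Finset.range (N₁ + 1), p j N' :=
          Finset.single_le_sum (f := fun N' => p j N') (fun _ _ => Nat.zero_le _)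
            (Finset.mem_range.2 (Nat.lt_succ_of_le hN))
      _ ≤ P := Finset.single_le_sum (f := fun j' => ∑ N' ∈ Finset.range (N₁ + 1), p j' N')
          (fun _ _ => Finset.sum_nonneg fun _ _ => Nat.zero_le _) (Finset.mem_univ j)
  have hCC : ∀ j N, N ≤ N₁ → |C j N| ≤ Cmax := by
    intro j N hN
    calc |C j N| ≤ ∑ N' ∈ Finset.range (N₁ + 1), |C j N'| :=
          Finset.single_le_sum (f := fun N' => |C j N'|) (fun _ _ => abs_nonneg _)
            (Finset.mem_range.2 (Nat.lt_succ_of_le hN))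
      _ ≤ Cmax := Finset.single_le_sum (f := fun j' => ∑ N' ∈ Finset.range (N₁ + 1), |C j' N'|)
          (fun _ _ => Finset.sum_nonneg fun _ _ => abs_nonneg _) (Finset.mem_univ j)
  set A : ℝ := ‖ξ‖ + d with hAdef
  have hA0 : 0 ≤ A := by positivity
  refine ⟨N₁ + P + 6 * M₀, Cmax * (1 + 1 / d) ^ P * (2 * (1 + A)) ^ (2 * M₀), by positivity, ?_⟩
  intro s hs j N hN f g hf hg F hF
  set L : ℝ := s + s⁻¹ with hLdef
  have hs' : 0 < s⁻¹ := inv_pos.2 hs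
  have hL1 : 1 ≤ L := by
    rcases le_or_gt 1 s with h | h; · linarith
    linarith [(one_le_inv₀ hs).2 h.le]
  have hsL : s ≤ L := by linarith
  set f' : 𝓢(EuclideanSpace ℝ (Fin 4), ℂ) := dilateTest s hs.ne' f with hf'def
  set g' : 𝓢(EuclideanSpace ℝ (Fin 4), ℂ) := dilateTest s hs.ne' g with hg'def
  set α : ℝ := s * (⟪ξ, nrm j⟫_ℝ + d) with hαdef
  set δ' : ℝ := min (s * d) 1 with hδ'def
  have hδ' : 0 < δ' := lt_min (mul_pos hs hd) one_pos
  have hδ'1 : δ' ≤ 1 := min_le_right _ _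
  -- supports of the dilates are separated by the slab `{α < ⟪·, n_j⟫ < α + δ'}`
  have hf' : tsupport (f' : EuclideanSpace ℝ (Fin 4) → ℂ) ⊆ {x | ⟪x, nrm j⟫_ℝ < α} := by
    intro x hx
    have h := hf (inv_smul_mem_tsupport_of_mem_tsupport_dilateTest hs.ne' f hx) j
    rw [inner_sub_left, real_inner_smul_left] at h
    have h2 : s * (s⁻¹ * ⟪x, nrm j⟫_ℝ - ⟪ξ, nrm j⟫_ℝ) < s * d := mul_lt_mul_of_pos_left h hs
    have h3 : s * (s⁻¹ * ⟪x, nrm j⟫_ℝ) = ⟪x, nrm j⟫_ℝ := by rw [← mul_assoc, mul_inv_cancel₀ hs.ne', one_mul]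
    show ⟪x, nrm j⟫_ℝ < s * (⟪ξ, nrm j⟫_ℝ + d)
    nlinarith
  have hg' : tsupport (g' : EuclideanSpace ℝ (Fin 4) → ℂ) ⊆ {x | α + δ' < ⟪x, nrm j⟫_ℝ} := by
    intro x hx
    have h := hg (inv_smul_mem_tsupport_of_mem_tsupport_dilateTest hs.ne' g hx) j
    rw [real_inner_smul_left] at h
    have h2 : s * -d < s * (s⁻¹ * ⟪x, nrm j⟫_ℝ) := mul_lt_mul_of_pos_left h hs
    have h3 : s * (s⁻¹ * ⟪x, nrm j⟫_ℝ) = ⟪x, nrm j⟫_ℝ := by rw [← mul_assoc, mul_inv_cancel₀ hs.ne', one_mul]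
    have h4 : α + δ' ≤ s * -d := by
      have := hdξ j
      have h5 : δ' ≤ s * d := min_le_left _ _
      nlinarith
    show α + δ' < ⟪x, nrm j⟫_ℝ
    linarith
  -- the slab bound for the dilated functions
  have hslab := norm_two_point_le_of_slab S₁ hT (hn1 j) (hA j N) hδ' hδ'1 f' g' hf' hg'
  -- `D_s F = sᴺ • G` with `G` a tensor of the dilated functions
  obtain ⟨G, hG, hDG⟩ : ∃ G : 𝓢((Fin 2 → EuclideanSpace ℝ (Fin 4)), ℂ),
      (IsTensorOf G ![((∂_{nrm j} : 𝓢(EuclideanSpace ℝ (Fin 4), ℂ) → 𝓢(EuclideanSpace ℝ (Fin 4), ℂ))^[N] f'), g'] ∨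
        IsTensorOf G ![f', ((∂_{nrm j} : 𝓢(EuclideanSpace ℝ (Fin 4), ℂ) → 𝓢(EuclideanSpace ℝ (Fin 4), ℂ))^[N] g')]) ∧
      dilateTest s hs.ne' F = ((s : ℂ) ^ N) • G := by
    rcases hF with hF | hF
    · refine ⟨_, Or.inl (isTensorOf_tensorFin _), ?_⟩
      rw [hF.unique (isTensorOf_tensorFin _), dilateTest_tensorFin_two, dilateTest_iterate_lineDerivOp,
        tensorFin_two_smul_left]
    · refine ⟨_, Or.inr (isTensorOf_tensorFin _), ?_⟩
      rw [hF.unique (isTensorOf_tensorFin _), dilateTest_tensorFin_two, dilateTest_iterate_lineDerivOp,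
        tensorFin_two_smul_right]
  rw [hDG, map_smul, norm_smul, norm_pow, Complex.norm_real, Real.norm_of_nonneg hs.le]
  -- component bounds
  have h1 : s ^ N ≤ L ^ N₁ := (pow_le_pow_left₀ hs.le hsL N).trans (pow_le_pow_right₀ hL1 hN)
  have h2 : |C j N| ≤ Cmax := hCC j N hN
  have h3 : (1 / δ') ^ (p j N) ≤ L ^ P * (1 + 1 / d) ^ P := by
    have hb : 1 / δ' ≤ L * (1 + 1 / d) := one_div_min_mul_le hs hd
    have hb1 : 1 ≤ L * (1 + 1 / d) := by nlinarith [one_div_pos.2 hd]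
    calc (1 / δ') ^ (p j N) ≤ (L * (1 + 1 / d)) ^ (p j N) := pow_le_pow_left₀ (by positivity) hb _
      _ ≤ (L * (1 + 1 / d)) ^ P := pow_le_pow_right₀ hb1 (hpP j N hN)
      _ = L ^ P * (1 + 1 / d) ^ P := mul_pow _ _ _
  have h4 : (2 * (1 + |α|)) ^ (2 * M₀) ≤ L ^ (2 * M₀) * (2 * (1 + A)) ^ (2 * M₀) := by
    have hα : |α| ≤ s * A := by
      rw [hαdef, abs_mul, abs_of_pos hs]
      refine mul_le_mul_of_nonneg_left ?_ hs.le
      calc |⟪ξ, nrm j⟫_ℝ + d| ≤ |⟪ξ, nrm j⟫_ℝ| + |d| := abs_add_le _ _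
        _ ≤ ‖ξ‖ * ‖nrm j‖ + d := by rw [abs_of_pos hd]; exact add_le_add (abs_real_inner_le_norm _ _) le_rfl
        _ = A := by rw [hn1 j, mul_one]
    have hb : 2 * (1 + |α|) ≤ L * (2 * (1 + A)) := by nlinarith
    calc (2 * (1 + |α|)) ^ (2 * M₀) ≤ (L * (2 * (1 + A))) ^ (2 * M₀) := pow_le_pow_left₀ (by positivity) hb _
      _ = L ^ (2 * M₀) * (2 * (1 + A)) ^ (2 * M₀) := mul_pow _ _ _
  have h5 : schwartzNorm M₀ f' ≤ L ^ (2 * M₀) * schwartzNorm M₀ f := schwartzNorm_dilateTest_le hs M₀ f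
  have h6 : schwartzNorm M₀ g' ≤ L ^ (2 * M₀) * schwartzNorm M₀ g := schwartzNorm_dilateTest_le hs M₀ g
  have hsf := schwartzNorm_nonneg M₀ f
  have hsg := schwartzNorm_nonneg M₀ g
  have hsf' := schwartzNorm_nonneg M₀ f'
  have hsg' := schwartzNorm_nonneg M₀ g'
  have hCmax : 0 ≤ Cmax := (abs_nonneg _).trans h2
  calc s ^ N * ‖S₁ 2 G‖
      ≤ s ^ N * (|C j N| * (1 / δ') ^ (p j N) * (2 * (1 + |α|)) ^ (2 * M₀) * schwartzNorm M₀ f' *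
          schwartzNorm M₀ g') := mul_le_mul_of_nonneg_left (hslab G hG) (pow_nonneg hs.le N)
    _ ≤ L ^ N₁ * (Cmax * (L ^ P * (1 + 1 / d) ^ P) * (L ^ (2 * M₀) * (2 * (1 + A)) ^ (2 * M₀)) *
          (L ^ (2 * M₀) * schwartzNorm M₀ f) * (L ^ (2 * M₀) * schwartzNorm M₀ g)) := by
        gcongr
    _ = Cmax * (1 + 1 / d) ^ P * (2 * (1 + A)) ^ (2 * M₀) * L ^ (N₁ + P + 6 * M₀) *
          schwartzNorm M₀ f * schwartzNorm M₀ g := by ring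

end Scaled

/-- **Sub-goal `ScaledChartBound`** (helper for stub `KernelOffDiagonal`): the scaled chart bound
`scaled_chart_bound`, registered form. [folklore] -/
theorem ScaledChartBound : open Literature.MathematicalPhysics.QuantumLattice Literature.MathematicalPhysics.AQFT Literature.MathematicalPhysics.QuantumFieldTheory in ∀ (S₁ : SchwingerFamily (EuclideanSpace ℝ (Fin 4))), (∀ (n : ℕ) (a : (EuclideanSpace ℝ (Fin 4))) (F : SchwartzMap (Fin n → (EuclideanSpace ℝ (Fin 4))) ℂ), IsOffDiagonal F → S₁ n (translateMulti a F) = S₁ n F) → ∀ (nrm : Fin 4 → (EuclideanSpace ℝ (Fin 4))), (∀ j : Fin 4, ‖nrm j‖ = 1) → ∀ (M₀ : ℕ) (C : Fin 4 → ℕ → ℝ) (p : Fin 4 → ℕ → ℕ), (∀ (j : Fin 4) (N : ℕ) (δ : ℝ), 0 < δ → δ ≤ 1 → ∀ (f g : SchwartzMap (EuclideanSpace ℝ (Fin 4)) ℂ), tsupport (f : (EuclideanSpace ℝ (Fin 4)) → ℂ) ⊆ {x : (EuclideanSpace ℝ (Fin 4)) | inner ℝ x (nrm j) < 0} → tsupport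 (g : (EuclideanSpace ℝ (Fin 4)) → ℂ) ⊆ {x : (EuclideanSpace ℝ (Fin 4)) | δ < inner ℝ x (nrm j)} → ∀ F : SchwartzMap (Fin 2 → (EuclideanSpace ℝ (Fin 4))) ℂ, (IsTensorOf F ![((LineDeriv.lineDerivOp (nrm j) : SchwartzMap (EuclideanSpace ℝ (Fin 4)) ℂ → SchwartzMap (EuclideanSpace ℝ (Fin 4)) ℂ)^[N] f), g] ∨ IsTensorOf F ![f, ((LineDeriv.lineDerivOp (nrm j) : SchwartzMap (EuclideanSpace ℝ (Fin 4)) ℂ → SchwartzMap (EuclideanSpace ℝ (Fin 4)) ℂ)^[N] g)]) → ‖S₁ 2 F‖ ≤ C j N * (1 / δ) ^ (p j N) * schwartzNorm M₀ f * schwartzNorm M₀ g) → ∀ (ξ : (EuclideanSpace ℝ (Fin 4))) (d : ℝ), 0 < d → (∀ j : Fin 4, inner ℝ ξ (nrm j) ≤ -(3 * d)) → ∀ N₁ : ℕ, ∃ (q : ℕ) (C₀ : ℝ), 0 ≤ C₀ ∧ ∀ (s : ℝ) (hs : 0 < s) (j : Fin 4) (N : ℕ), N ≤ N₁ → ∀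 (f g : SchwartzMap (EuclideanSpace ℝ (Fin 4)) ℂ), tsupport (f : (EuclideanSpace ℝ (Fin 4)) → ℂ) ⊆ {x : (EuclideanSpace ℝ (Fin 4)) | ∀ i : Fin 4, inner ℝ (x - ξ) (nrm i) < d} → tsupport (g : (EuclideanSpace ℝ (Fin 4)) → ℂ) ⊆ {y : (EuclideanSpace ℝ (Fin 4)) | ∀ i : Fin 4, -d < inner ℝ y (nrm i)} → ∀ F : SchwartzMap (Fin 2 → (EuclideanSpace ℝ (Fin 4))) ℂ, (IsTensorOf F ![((LineDeriv.lineDerivOp (nrm j) : SchwartzMap (EuclideanSpace ℝ (Fin 4)) ℂ → SchwartzMap (EuclideanSpace ℝ (Fin 4)) ℂ)^[N] f), g] ∨ IsTensorOf F ![f, ((LineDeriv.lineDerivOp (nrm j) : SchwartzMap (EuclideanSpace ℝ (Fin 4)) ℂ → SchwartzMap (EuclideanSpace ℝ (Fin 4)) ℂ)^[N] g)]) → ‖S₁ 2 (dilateTest s hs.ne' F)‖ ≤ C₀ * (s + s⁻¹) ^ q * schwartzNorm M₀ f * schwartzNorm M₀ g := by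
  intro S₁ hT nrm hn1 M₀ C p hA ξ d hd hdξ N₁
  exact scaled_chart_bound S₁ hT nrm hn1 M₀ C p hA ξ hd hdξ N₁

end Summit.QuantumFields.YangMills.Theorems.CurvatureKernel

end
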